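import Summits.CriticalPhenomena.PercolationContinuityZ3.Theorems.PercNearOneGluingNoHeavyLowerTailFrontierDecRowsClusterMarkov
import Summits.CriticalPhenomena.PercolationContinuityZ3.Theorems.PercNearOneGluingNoHeavyLowerTailHybridThreePointLB
import HarnessLib

/-!
# The four-point decreasing cubic frontier: the 'cone-implied' essential rows as theorems for every `n` — I: the single hybrid-3PT-LB instances

Support file (prover prim-l12-p1 gen 3, P1 line; `--supports stmt-CriticalPhenomena-4575`).  No definitions, no named facts, no sorries, no
`native_decide`.  `…FrontierDecRowsLeFive` (prim-bnk-1) lists 45 essential `S₄`-orbits of decreasing four-point `E₃` rows; 8 of them (rows 8, 9, 16, 17, 19, 32,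
40, 43) were marked "implied by the proved cubic families + Harris (exact cone certificates)" but only certified in Lean for `n ≤ 5`.  This file records the three of
them that are literally ONE instance of the hybrid three-point lower bound `HybridThreePointLB.sahiE3_hybrid_nonneg` (`E₃({P₁≁c},{c≁P₃},{P₁≁P₃'}) ≥ 0`,
`P₃ ⊆ P₃'`; prim-ineq-gen-8 / prim-cert-2), for EVERY `n`, all weights, all `a b c y`:
* row 19 `(D[ab|c], D[a|y], D[c|y])`  = hybrid row with hub `y`, `P₁ = {c}`, `P₃ = {a} ⊆ P₃' = {a,b}`;
* row 40 `(D[ab|c], D[ab|y], D[c|y])` = hybrid row with hub `c`, `P₁ = {y}`, `P₃ = P₃' = {a,b}`;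
* row 43 `(D[a|b], D[a|c], D[b|c])`   = 3PT-LB = SHK3⁺ itself (`ThreePointLB.sahiE3_pairSep_nonneg`).
(Rows 8, 9, 16, 17, 32 need short cone certificates over several proved rows; not in this file.)
-/

noncomputable section

namespace Summit.CriticalPhenomena.PercolationContinuityZ3.Theorems.FrontierDecRows

open MeasureTheory CovTransferCert E3GroupSepCert HybridRows ClusterMarkovE3
open Literature.Probability.Percolation Literature.Probability.LatticeModels

variable {n : ℕ}

/-- `connEvent (sep [x] L)` in the hub form of `HybridThreePointLB` (`{ω | ∀ u ∈ S, ω ∉ openConn x u}`, `S` a finset with the same members as `L`).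
[folklore] -/
theorem connEvent_sep_singleton_eq (x : Fin n) (L : List (Fin n)) (S : Finset (Fin n)) (hS : ∀ u, u ∈ S ↔ u ∈ L) :
    connEvent (sep [x] L) = {ω : BondConfig (Fin n) | ∀ u ∈ S, ω ∉ openConn x u} := by
  rw [connEvent_sep]
  ext ω
  simp only [List.mem_singleton, forall_eq, Set.mem_setOf_eq]
  exact ⟨fun h u hu => h u ((hS u).1 hu), fun h u hu => h u ((hS u).2 hu)⟩

/-- `connEvent (sep L M)` in the two-set form of `HybridThreePointLB` (`{ω | ∀ v ∈ S, ∀ u ∈ T, ω ∉ openConn v u}`). [folklore] -/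
theorem connEvent_sep_eq_finset (L M : List (Fin n)) (S T : Finset (Fin n)) (hS : ∀ u, u ∈ S ↔ u ∈ L) (hT : ∀ u, u ∈ T ↔ u ∈ M) :
    connEvent (sep L M) = {ω : BondConfig (Fin n) | ∀ v ∈ S, ∀ u ∈ T, ω ∉ openConn v u} := by
  rw [connEvent_sep]
  ext ω
  simp only [Set.mem_setOf_eq]
  exact ⟨fun h v hv u hu => h v ((hS v).1 hv) u ((hT u).1 hu), fun h v hv u hu => h v ((hS v).2 hv) u ((hT u).2 hu)⟩

/-- Row `19` = `(D[ab|c], D[a|y], D[c|y])` on EVERY finite weighted graph: the hybrid three-point row with hub `y`, `P₁ = {c}`, `P₃ = {a}`, `P₃' = {a,b}`.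
[this work] -/
theorem frontier_19_all (w : Sym2 (Fin n) → unitInterval) (a b c y : Fin n) :
    0 ≤ sahiE3 (prodBernoulli w) (connEvent (row 19 n (a, b, c, y)).1) (connEvent (row 19 n (a, b, c, y)).2.1)
      (connEvent (row 19 n (a, b, c, y)).2.2) := by
  classical
  have hr : row 19 n (a, b, c, y) = (sep [a, b] [c], sep [a] [y], sep [c] [y]) := rfl
  rw [hr]
  -- E₃(D[ab|c], D[a|y], D[c|y]) = E₃(D[c|y], D[a|y], D[ab|c]) (swap slots 1,3) = hybrid(y; {c}; {a} ⊆ {a,b}) after rewriting the events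
  have h := HybridThreePointLB.sahiE3_hybrid_nonneg w y ({c} : Finset (Fin n)) ({a} : Finset (Fin n)) ({a, b} : Finset (Fin n))
    (Finset.singleton_subset_iff.2 (Finset.mem_insert_self a {b}))
  have e1 : connEvent (sep [c] [y]) = {ω : BondConfig (Fin n) | ∀ u ∈ ({c} : Finset (Fin n)), ω ∉ openConn y u} := by
    rw [connEvent_sep_comm]; exact connEvent_sep_singleton_eq y [c] {c} (fun u => by simp)
  have e2 : connEvent (sep [a] [y]) = {ω : BondConfig (Fin n) | ∀ v ∈ ({a} : Finset (Fin n)), ω ∉ openConn y v} := by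
    rw [connEvent_sep_comm]; exact connEvent_sep_singleton_eq y [a] {a} (fun u => by simp)
  have e3 : connEvent (sep [a, b] [c]) = {ω : BondConfig (Fin n) | ∀ v ∈ ({a, b} : Finset (Fin n)), ∀ u ∈ ({c} : Finset (Fin n)), ω ∉ openConn v u} :=
    connEvent_sep_eq_finset [a, b] [c] {a, b} {c} (fun u => by simp) (fun u => by simp)
  rw [sahiE3_comm₁₂, sahiE3_comm₂₃, sahiE3_comm₁₂, e1, e2, e3]
  exact h

/-- Row `40` = `(D[ab|c], D[ab|y], D[c|y])` on EVERY finite weighted graph: the hybrid three-point row with hub `c`, `P₁ = {y}`, `P₃ = P₃' = {a,b}`.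
[this work] -/
theorem frontier_40_all (w : Sym2 (Fin n) → unitInterval) (a b c y : Fin n) :
    0 ≤ sahiE3 (prodBernoulli w) (connEvent (row 40 n (a, b, c, y)).1) (connEvent (row 40 n (a, b, c, y)).2.1)
      (connEvent (row 40 n (a, b, c, y)).2.2) := by
  classical
  have hr : row 40 n (a, b, c, y) = (sep [a, b] [c], sep [a, b] [y], sep [c] [y]) := rfl
  rw [hr]
  have h := HybridThreePointLB.sahiE3_hybrid_nonneg w c ({y} : Finset (Fin n)) ({a, b} : Finset (Fin n)) ({a, b} : Finset (Fin n))
    (Finset.Subset.refl _)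
  have e1 : connEvent (sep [c] [y]) = {ω : BondConfig (Fin n) | ∀ u ∈ ({y} : Finset (Fin n)), ω ∉ openConn c u} :=
    connEvent_sep_singleton_eq c [y] {y} (fun u => by simp)
  have e2 : connEvent (sep [a, b] [c]) = {ω : BondConfig (Fin n) | ∀ v ∈ ({a, b} : Finset (Fin n)), ω ∉ openConn c v} := by
    rw [connEvent_sep_comm]; exact connEvent_sep_singleton_eq c [a, b] {a, b} (fun u => by simp)
  have e3 : connEvent (sep [a, b] [y]) = {ω : BondConfig (Fin n) | ∀ v ∈ ({a, b} : Finset (Fin n)), ∀ u ∈ ({y} : Finset (Fin n)), ω ∉ openConn v u} :=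
    connEvent_sep_eq_finset [a, b] [y] {a, b} {y} (fun u => by simp) (fun u => by simp)
  -- target order (D[ab|c], D[ab|y], D[c|y]); hybrid order ({y≁c}, {c≁ab}, {y≁ab}) = (D[c|y], D[ab|c], D[ab|y])
  rw [sahiE3_comm₂₃, sahiE3_comm₁₂, e1, e2, e3]
  exact h

/-- Row `43` = `(D[a|b], D[a|c], D[b|c])` on EVERY finite weighted graph: 3PT-LB = SHK3⁺ (`ThreePointLB.sahiE3_pairSep_nonneg`). [this work] -/
theorem frontier_43_all (w : Sym2 (Fin n) → unitInterval) (a b c y : Fin n) :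
    0 ≤ sahiE3 (prodBernoulli w) (connEvent (row 43 n (a, b, c, y)).1) (connEvent (row 43 n (a, b, c, y)).2.1)
      (connEvent (row 43 n (a, b, c, y)).2.2) := by
  have hr : row 43 n (a, b, c, y) = (sep [a] [b], sep [a] [c], sep [b] [c]) := rfl
  rw [hr]
  have e : ∀ u v : Fin n, connEvent (sep [u] [v]) = (openConn u v)ᶜ := fun u v => by
    rw [connEvent_sep]; ext ω; simp
  rw [e a b, e a c, e b c]
  exact ThreePointLB.sahiE3_pairSep_nonneg w a b c

/-- Rows 19, 40, 43 in term form, all `n`. [this work] -/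
theorem frontier_19_40_43_cval_all (w : Sym2 (Fin n) → unitInterval) (a b c y : Fin n) :
    0 ≤ cval w (terms 19 n (a, b, c, y)) ∧ 0 ≤ cval w (terms 40 n (a, b, c, y)) ∧ 0 ≤ cval w (terms 43 n (a, b, c, y)) :=
  ⟨cval_terms_nonneg_of_sahiE3 19 w a b c y (frontier_19_all w a b c y), cval_terms_nonneg_of_sahiE3 40 w a b c y (frontier_40_all w a b c y),
    cval_terms_nonneg_of_sahiE3 43 w a b c y (frontier_43_all w a b c y)⟩

end Summit.CriticalPhenomena.PercolationContinuityZ3.Theorems.FrontierDecRows
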